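import Summits.Parity.GeneralizedHardyLittlewood.Theorems.PrimeLevelFamEdgeMomentsBeyondDiagonalDiagOrderAssembly
import Summits.Parity.GeneralizedHardyLittlewood.Theorems.PrimeLevelFamEdgeMomentsBeyondDiagonalDiagOrderZero
import HarnessLib

/-!
# Route `PrimeLevelFamEdge`, crux K_A `MomentsBeyondDiagonal` (stmt-Parity-20007), line «petersson_layers» v4, stub `stub_diag`:
# **`SubDiag` ⟸ the per-order `Q`-free targets of POSITIVE order only** (order `(0,0)` discharged)

Composition of `…DiagOrderAssembly` (p821647: `SubDiag` ⟸ one `Q`-free asymptotic per order `(i,j)`, `i+j` even) with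
`…DiagOrderZero` (the order-`(0,0)` target holds with `τ₀₀(Δ',P) = secondMomentForm Δ' P 1 / 2`, from the `Q = 1` chain):

* `hasShape_diagPart_of_orderAsymptotics_pos` — `HasShape diagPart Δ t` (`Δ ≤ 3/2`) from the targets of the orders
  `(i,j) ≠ (0,0)`, `i + j` even, for any level-free family `τ_{ij}` normalised by `τ₀₀(Δ',P) = secondMomentForm Δ' P 1 / 2`,
  with `t(Δ',P,Q) = Σ_{i,j ≤ deg Q} QᵢQⱼ(1+(−1)^{i+j}) τ_{ij}(Δ',P)`;
* `subDiag_of_orderAsymptotics_pos` — hence `SubDiag`.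

So what remains of the registered stub `stub_diag` is EXACTLY the list of `Q`-free per-order asymptotics for
`(i,j) ∈ {(1,1), (2,0), (0,2), (3,1), (2,2), …}` (census R3(ii): polynomial part of the Bose coefficients through the decorated
engines + the Abel/corner step for the remainders `r_ab`). Def-free; helper `--supports stmt-Parity-20007`; closes nothing;
K_A, K_B and the Parity summit are NOT proved; nothing about Landau–Siegel zeros.

## References
* E. Kowalski, P. Michel, J. VanderKam, J. reine angew. Math. 526 (2000), (23)–(28) pp. 13–15, Prop. 5.1 (31) p. 18.
  [cite: KowalskiMichelVanderKam2000, (23)–(28) pp. 13–15 — derivation]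
-/

noncomputable section

open scoped Real
open Complex MeasureTheory Polynomial
open Literature.NumberTheory.LFunctions

namespace Summit.Parity.GeneralizedHardyLittlewood.Theorems.MomentsBeyondDiagonal.DiagLines

open Summit.Parity.GeneralizedHardyLittlewood.Theorems.PrimeLevelFamEdgeIdeaDeltas.PeterssonLayers
  (diagPart HasShape SubOf SubDiag)

/-- **`HasShape diagPart` from the per-order `Q`-free targets of POSITIVE order** (`Δ ≤ 3/2`; the order-`(0,0)` target is
`…DiagOrderZero.lineSeries_order_zero_asymp`), for any level-free family `τ_{ij}` normalised by
`τ₀₀(Δ',P) = secondMomentForm Δ' P 1 / 2`; the functional is `t(Δ',P,Q) = Σ_{i,j ≤ deg Q} QᵢQⱼ(1+(−1)^{i+j}) τ_{ij}(Δ',P)`.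
[cite: KowalskiMichelVanderKam2000, (23)–(28) pp. 13–15 — derivation] -/
theorem hasShape_diagPart_of_orderAsymptotics_pos {Δ : ℝ} (hΔ : Δ ≤ 3 / 2) (τ : ℕ → ℕ → ℝ → ℝ[X] → ℝ)
    (h0 : ∀ (Δ' : ℝ) (P : ℝ[X]), τ 0 0 Δ' P = KMV2000.secondMomentForm Δ' P 1 / 2)
    (h : ∀ i j : ℕ, Even (i + j) → ¬(i = 0 ∧ j = 0) → ∀ P : ℝ[X], KMV2000.Admissible P → ∀ Δ' : ℝ, 1 < Δ' → Δ' ≤ Δ →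
      ∃ C : ℝ, ∃ q₀ : ℕ, ∀ (q : ℕ) [NeZero q], q₀ ≤ q →
        ‖(((Real.log (KMV2000.qhat q))⁻¹ : ℝ) : ℂ) ^ (i + j) * (KMV2000.qhat q : ℂ) *
          ∑ m₁ ∈ Finset.Icc 1 ⌊KMV2000.qhat q ^ Δ'⌋₊, ∑ m₂ ∈ Finset.Icc 1 ⌊KMV2000.qhat q ^ Δ'⌋₊,
            (KMV2000.mollifierCoeff P (KMV2000.qhat q ^ Δ') m₁ : ℂ) *
              (KMV2000.mollifierCoeff P (KMV2000.qhat q ^ Δ') m₂ : ℂ) *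
            ∑ d₁ ∈ m₁.divisors, ∑ d₂ ∈ m₂.divisors,
              (((((m₁ / d₁).gcd (m₂ / d₂) : ℝ) * ((m₁ : ℝ) * m₂) ^ (-(1 / 2 : ℝ)) *
                (∫ u₁ in Set.Ioi (0 : ℝ),
                  (Real.log (KMV2000.qhat q / ((d₁ * (m₂ / d₂ / (m₁ / d₁).gcd (m₂ / d₂)) : ℕ) : ℝ)) + Real.log u₁) ^ i *
                  ∫ u₂ in Set.Ioi (((((m₁ / (m₁ / d₁).gcd (m₂ / d₂)) * (m₂ / (m₁ / d₁).gcd (m₂ / d₂)) : ℕ) : ℝ) /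
                      KMV2000.qhat q ^ 2) / u₁),
                    Real.exp (-(u₁ + u₂)) / (1 - Real.exp (-(u₁ + u₂))) ^ 2 *
                    (Real.log (KMV2000.qhat q / ((d₂ * (m₁ / d₁ / (m₁ / d₁).gcd (m₂ / d₂)) : ℕ) : ℝ)) + Real.log u₂) ^ j)) : ℝ) : ℂ) -
          ((2 * riemannZeta 2 ^ 2 *
              ((KMV2000.qhat q / (Δ' ^ 2 * Real.log (KMV2000.qhat q) ^ 2) : ℝ) : ℂ)) * ((τ i j Δ' P : ℝ) : ℂ))‖ ≤
          C * KMV2000.qhat q * (Real.log (KMV2000.qhat q))⁻¹ ^ 3) :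
    HasShape (fun q _ P Q Δ' ↦ diagPart q P Q Δ') Δ
      (fun Δ' P Q ↦ ∑ i ∈ Finset.range (Q.natDegree + 1), ∑ j ∈ Finset.range (Q.natDegree + 1),
        Q.coeff i * Q.coeff j * (1 + (-1 : ℝ) ^ (i + j)) * τ i j Δ' P) := by
  refine hasShape_diagPart_of_orderAsymptotics hΔ τ ?_
  intro i j hij P hP Δ' h1 h2
  by_cases h00 : i = 0 ∧ j = 0
  · obtain ⟨rfl, rfl⟩ := h00
    rw [h0 Δ' P]
    exact lineSeries_order_zero_asymp hP h1 (h2.trans hΔ)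
  · exact h i j hij h00 P hP Δ' h1 h2

/-- **`SubDiag` from the per-order `Q`-free targets of POSITIVE order** on some window `(1, Δ]`, `1 < Δ ≤ 3/2`: what remains of the
registered stub `stub_diag` after the order-`(0,0)` discharge is exactly the family of asymptotics for the orders `(i,j) ≠ (0,0)` with
`i + j` even. [cite: KowalskiMichelVanderKam2000, (23)–(28) pp. 13–15 — derivation] -/
theorem subDiag_of_orderAsymptotics_pos {Δ : ℝ} (hΔ1 : 1 < Δ) (hΔ : Δ ≤ 3 / 2) (τ : ℕ → ℕ → ℝ → ℝ[X] → ℝ)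
    (h0 : ∀ (Δ' : ℝ) (P : ℝ[X]), τ 0 0 Δ' P = KMV2000.secondMomentForm Δ' P 1 / 2)
    (h : ∀ i j : ℕ, Even (i + j) → ¬(i = 0 ∧ j = 0) → ∀ P : ℝ[X], KMV2000.Admissible P → ∀ Δ' : ℝ, 1 < Δ' → Δ' ≤ Δ →
      ∃ C : ℝ, ∃ q₀ : ℕ, ∀ (q : ℕ) [NeZero q], q₀ ≤ q →
        ‖(((Real.log (KMV2000.qhat q))⁻¹ : ℝ) : ℂ) ^ (i + j) * (KMV2000.qhat q : ℂ) *
          ∑ m₁ ∈ Finset.Icc 1 ⌊KMV2000.qhat q ^ Δ'⌋₊, ∑ m₂ ∈ Finset.Icc 1 ⌊KMV2000.qhat q ^ Δ'⌋₊,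
            (KMV2000.mollifierCoeff P (KMV2000.qhat q ^ Δ') m₁ : ℂ) *
              (KMV2000.mollifierCoeff P (KMV2000.qhat q ^ Δ') m₂ : ℂ) *
            ∑ d₁ ∈ m₁.divisors, ∑ d₂ ∈ m₂.divisors,
              (((((m₁ / d₁).gcd (m₂ / d₂) : ℝ) * ((m₁ : ℝ) * m₂) ^ (-(1 / 2 : ℝ)) *
                (∫ u₁ in Set.Ioi (0 : ℝ),
                  (Real.log (KMV2000.qhat q / ((d₁ * (m₂ / d₂ / (m₁ / d₁).gcd (m₂ / d₂)) : ℕ) : ℝ)) + Real.log u₁) ^ i *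
                  ∫ u₂ in Set.Ioi (((((m₁ / (m₁ / d₁).gcd (m₂ / d₂)) * (m₂ / (m₁ / d₁).gcd (m₂ / d₂)) : ℕ) : ℝ) /
                      KMV2000.qhat q ^ 2) / u₁),
                    Real.exp (-(u₁ + u₂)) / (1 - Real.exp (-(u₁ + u₂))) ^ 2 *
                    (Real.log (KMV2000.qhat q / ((d₂ * (m₁ / d₁ / (m₁ / d₁).gcd (m₂ / d₂)) : ℕ) : ℝ)) + Real.log u₂) ^ j)) : ℝ) : ℂ) -
          ((2 * riemannZeta 2 ^ 2 *
              ((KMV2000.qhat q / (Δ' ^ 2 * Real.log (KMV2000.qhat q) ^ 2) : ℝ) : ℂ)) * ((τ i j Δ' P : ℝ) : ℂ))‖ ≤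
          C * KMV2000.qhat q * (Real.log (KMV2000.qhat q))⁻¹ ^ 3) :
    SubDiag :=
  ⟨Δ, hΔ1, _, hasShape_diagPart_of_orderAsymptotics_pos hΔ τ h0 h⟩

end Summit.Parity.GeneralizedHardyLittlewood.Theorems.MomentsBeyondDiagonal.DiagLines

end
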